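import Literature.Topology.FourManifolds.HomotopySpheresStablyParallelizableThree
import Literature.Topology.FourManifolds.HomotopySpheresStablyParallelizableHomotopyGroup
import HarnessLib

/-!
# Kervaire–Milnor's Theorem 3.1: the clutching class `oₙ(Σ)` is the only obstruction (proved)

Topic `Literature/Topology/FourManifolds`, sibling of
`HomotopySpheresStablyParallelizableStandard.lean` and `…Three.lean`, towards the named fact
`Literature.Topology.FourManifolds.HomotopySphere.isStablyParallelizable` (Kervaire–Milnor,
*Groups of homotopy spheres I*, Ann. of Math. 77 (1963), Thm. 3.1, p. 508: "Every homotopy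
sphere is s-parallelizable"). Everything here is PROVED; there are no definitions and no named
facts.

The printed proof (p. 508) opens: "Let `Σ` be a homotopy `n`-sphere. Then the only obstruction to
the triviality of `τ ⊕ ε¹` is a well defined cohomology class
`oₙ(Σ) ∈ Hⁿ(Σ; πₙ₋₁(SO_{n+1})) = πₙ₋₁(SO_{n+1})`", and then shows `oₙ(Σ) = 0` in three cases
(Case 1, `n ≡ 3, 5, 6, 7 (mod 8)`: the whole group `πₙ₋₁(SO) = 0`; Case 2, `n ≡ 0, 4 (mod 8)`:
`pₖ(Σ)` is a nonzero multiple of `oₙ(Σ)` and `pₖ[Σ] = 0` by the signature theorem; Case 3,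
`n ≡ 1, 2 (mod 8)`: `Jₙ₋₁ oₙ(Σ) = 0` by Rohlin and `Jₙ₋₁` is injective by Adams). Kosinski,
*Differential Manifolds* (1993), IX §8, (8.2)–(8.4), spells the opening sentence out: a bundle
trivial off a point of `Mᵐ` is described by framings over a disc `D` and over `M ∖ Int D` and the
**clutching map** `γ : ∂D → GL`; "`ξ ⊕ ε¹ = f^*ξ(s_m γ)`; `ξ` is stably trivial if `s_m γ = 0`".

So far the tree's clutching theorem
(`isStablyParallelizable_of_hasStableTangentFramingAlong_compl_singleton`,
`HomotopySpheresStablyParallelizable.lean`) asked that **every** map `𝕊ⁿ → GL(n + 2, ℝ)` extend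
over the disc (`SphereMapsToStableFramesExtend n`, i.e. `πₙ(GL(n + 2, ℝ)) = 0`) — enough for
Case 1 only. This file proves the opening sentence itself, at the level of representatives:

* §1 `Literature.Topology.FourManifolds.HasStableTangentFramingAlong.exists_sections_compl_singleton`:
  a stable framing of `TM` off `q` (the tree's `HasStableTangentFramingAlong` along `{q}ᶜ ↪ M`)
  as `n + 2` global sections `sᵢ : M → ℝⁿ⁺¹ × ℝ`, continuous into `TM ⊕ ℝ` and linearly
  independent on `{q}ᶜ` (reindexing; the form in which the clutching map is read below).
* §2 `Literature.Topology.FourManifolds.isStablyParallelizable_of_nullhomotopic_clutchingMap`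
  (**"`oₙ = 0 ⇒ τ ⊕ ε¹` trivial"**): `M` a Hausdorff `C¹` manifold modelled on `ℝⁿ⁺¹`, `TM ⊕ ℝ`
  framed off `q` by sections `s`, `e` a chart of the maximal `C¹` atlas at `q`, `B̄(e q, r) ⊆
  e.target`. The clutching map of these data is `f : 𝕊ⁿ → StableFrame (n + 1)` (`≅ GL(n + 2, ℝ)`),
  `f(u) = (de × id)(s(e⁻¹(e q + r u)))` — the framing read in the chart on the sphere of radius
  `r` about `q`. **If `f` is null-homotopic, `M` is stably parallelizable.** (Proof as printed and
  as in the tree's clutching theorem, whose extension hypothesis is now applied to `f` alone: a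
  null-homotopic sphere map extends over `ℝⁿ⁺¹`, `exists_sphere_extends_of_nullhomotopic`; the
  extension, pushed forward by `de⁻¹`, reframes `TM ⊕ ℝ` over the chart ball and pastes with `s`
  along the sphere.) The clutching map is characterised by its values, so the hypothesis reads
  "every continuous `f` with these values is null-homotopic" (there is exactly one).
* §3 `Literature.Topology.FourManifolds.nullhomotopic_clutchingMap_of_framing`
  (**"`τ ⊕ ε¹` trivial `⇒ oₙ = 0`"**): conversely, if the sections `s` frame `TM ⊕ ℝ` over all of
  `e.source` (in particular at `q`), the clutching map is null-homotopic — shrink the sphere to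
  `q` inside the chart ball: `H(t, u) = (de × id)(s(e⁻¹(e q + (1 - t) r u)))`. Hence
  `Literature.Topology.FourManifolds.IsStablyParallelizable.exists_sections_nullhomotopic_clutchingMap`
  and the equivalence
  `Literature.Topology.FourManifolds.isStablyParallelizable_iff_exists_nullhomotopic_clutchingMap`:
  **a nonempty Hausdorff `C¹` manifold modelled on `ℝⁿ⁺¹` is stably parallelizable iff `TM ⊕ ℝ`
  is framed off some point with null-homotopic clutching map** — Kervaire–Milnor's "the only
  obstruction", Kosinski's (8.2)–(8.4).
* §4 Homotopy spheres. The framing off a point is a theorem of the tree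
  (`HomotopySphere.hasStableTangentFramingAlong_compl_singleton_holds`, `…Proofs.lean`), so
  clutching data always exist (`HomotopySphere.exists_clutchingData`), and
  `Literature.Topology.FourManifolds.HomotopySphere.isStablyParallelizable_of_bott_of_obstruction`
  sharpens the assembly `isStablyParallelizable_of_bott_of_cases` of `…Three.lean` to the exact
  shape of the printed proof: the named fact follows from (i) Bott's values
  `π_ (n - 1) (SO(n + 1), 1) = 0`, `n ≥ 5`, `n ≡ 3, 5, 6, 7 (mod 8)` (Case 1) and (ii) for `n = 4`
  and `n ≡ 0, 1, 2, 4 (mod 8)`, `n ≥ 8`: **every homotopy `n`-sphere has SOME clutching data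
  with null-homotopic clutching map** — the conclusion "`oₙ(Σ) = 0`" of Cases 2 and 3, whose
  proofs (Pontryagin classes and Hirzebruch's signature theorem; Rohlin's theorem and Adams'
  injectivity of `J` on `π₈ₖ(SO)`, `π₈ₖ₊₁(SO)`) need theories absent from Mathlib and the tree.
  Dimensions `≤ 3` stay unconditional (`isStablyParallelizable_of_le_three`).

Indexing: Kervaire–Milnor's dimension `n` is `n + 1` below (manifolds modelled on `ℝⁿ⁺¹`,
clutching maps on `𝕊ⁿ`, values in `StableFrame (n + 1) ≅ GL(n + 2, ℝ) ≃ O(n + 2)`, so the class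
lives in `πₙ(SO(n + 2)) = πₙ(SO)` — the tree's
`sphereMapsToStableFramesExtend_iff_subsingleton_homotopyGroup_specialOrthogonalGroup`).

## References

* M. Kervaire, J. Milnor, *Groups of homotopy spheres I*, Ann. of Math. (2) 77 (1963), 504–537:
  §3, Thm. 3.1 and its proof, pp. 508–509 (first sentence: `oₙ(Σ)` is the only obstruction;
  Cases 1–3). doi:10.2307/1970128 [KervaireMilnorAnnals1963]
* A. Kosinski, *Differential Manifolds*, Academic Press (1993), Ch. IX §8: (8.1) almost trivial
  bundles, Lemma (8.2), the clutching description before (8.3) ("`ξ ⊕ ε¹ = f^*ξ(s_m γ)`"),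
  Prop. (8.4), Cor. (8.6), pp. 189–191. [Kosinski1993]
* A. Hatcher, *Algebraic Topology*, CUP (2002), §4.1, p. 346 (a sphere map extends over the disc
  iff it is null-homotopic). [HatcherAT2002]
-/

open scoped Manifold ContDiff Topology unitInterval
open Set Function Bundle Metric Module

noncomputable section

namespace Literature.Topology.FourManifolds

section Clutching

variable {n : ℕ} {M : Type*} [TopologicalSpace M]
  [ChartedSpace (EuclideanSpace ℝ (Fin (n + 1))) M] [IsManifold (𝓡 (n + 1)) 1 M]

/-! ### 1. Stable framings off a point as global sections -/

/-- **A stable framing of `TM` off a point, as global sections.** If `TM ⊕ ℝ` is framed along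
the inclusion of `{q}ᶜ` (`HasStableTangentFramingAlong`, `Spin.lean`: `finrank ℝ ℝⁿ⁺¹ + 1`
sections on the subtype), then there are `n + 2` sections `sᵢ : M → ℝⁿ⁺¹ × ℝ` which on `{q}ᶜ`
are continuous into `TM` (first components) and into `ℝ` (second components) and pointwise
linearly independent (reindex by `Fin (n + 2)` and extend by `0` at `q`). [folklore] -/
theorem HasStableTangentFramingAlong.exists_sections_compl_singleton {q : M}
    (hq : HasStableTangentFramingAlong (𝓡 (n + 1)) M ((↑) : ((({q} : Set M)ᶜ : Set M)) → M)) :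
    ∃ s : Fin (n + 2) → M → EuclideanSpace ℝ (Fin (n + 1)) × ℝ,
      (∀ i, ContinuousOn (fun y => (TotalSpace.mk' (EuclideanSpace ℝ (Fin (n + 1))) y (s i y).1 :
        TangentBundle (𝓡 (n + 1)) M)) ({q}ᶜ : Set M)) ∧
      (∀ i, ContinuousOn (fun y => (s i y).2) ({q}ᶜ : Set M)) ∧
      ∀ y, y ≠ q → LinearIndependent ℝ fun i => s i y := by
  classical
  have hN : finrank ℝ (EuclideanSpace ℝ (Fin (n + 1))) + 1 = n + 2 := by simp
  obtain ⟨s₀, hs₀c, hs₀c', hs₀li⟩ := hq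
  let s' : Fin (n + 2) → M → EuclideanSpace ℝ (Fin (n + 1)) × ℝ := fun i y =>
    if h : y = q then 0 else s₀ (Fin.cast hN.symm i) ⟨y, mem_compl_singleton_iff.mpr h⟩
  have hs'eq : ∀ i (p : (({q} : Set M)ᶜ : Set M)), s' i p = s₀ (Fin.cast hN.symm i) p := by
    intro i p
    simp only [s', dif_neg (mem_compl_singleton_iff.mp p.2)]
  refine ⟨s', fun i => ?_, fun i => ?_, fun y hy => ?_⟩
  · rw [continuousOn_iff_continuous_restrict]
    convert hs₀c (Fin.cast hN.symm i) using 1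
    funext p
    simp only [restrict_apply, hs'eq]
  · rw [continuousOn_iff_continuous_restrict]
    convert hs₀c' (Fin.cast hN.symm i) using 1
    funext p
    simp only [restrict_apply, hs'eq]
  · have := (hs₀li ⟨y, mem_compl_singleton_iff.mpr hy⟩).comp (Fin.cast hN.symm)
      (Fin.cast_injective _)
    convert this using 1
    funext i
    exact hs'eq i ⟨y, _⟩

/-! ### 2. A null-homotopic clutching map makes `TM ⊕ ℝ` trivial -/

/-- **Kervaire–Milnor's obstruction, sufficiency: if the clutching map is null-homotopic, the
manifold is stably parallelizable** (Kervaire–Milnor 1963, proof of Thm. 3.1, p. 508, first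
sentence: "the only obstruction to the triviality of `τ ⊕ ε¹` is … `oₙ(Σ)`"; Kosinski,
*Differential Manifolds*, IX (8.2)–(8.4): "`ξ` is stably trivial if `s_m γ` vanishes"). Let `M` be
a Hausdorff `C¹` manifold modelled on `ℝⁿ⁺¹`, `q ∈ M`, and let `sᵢ : M → ℝⁿ⁺¹ × ℝ`, `i < n + 2`,
frame `TM ⊕ ℝ` over `M ∖ {q}` (continuous into `TM ⊕ ℝ` and linearly independent there). Let `e`
be a chart of the maximal `C¹` atlas with `q ∈ e.source` and `B̄(e q, r) ⊆ e.target`, `r > 0`.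
The **clutching map** of these data is the continuous map `f : 𝕊ⁿ → StableFrame (n + 1)`,
`f(u)ᵢ = (de (sᵢ(y)).1, (sᵢ(y)).2)` at `y = e⁻¹(e q + r u)` — the framing read in the chart on
the sphere of radius `r` about `q` (Kosinski's `γ : ∂D → GL`, suspended). If `f` is
null-homotopic (hypothesis `hobs`, stated for every continuous map with these values — there is
exactly one), then `M` is stably parallelizable.

*Proof.* A null-homotopic map of `𝕊ⁿ` extends to `F : ℝⁿ⁺¹ → StableFrame (n + 1)`
(`exists_sphere_extends_of_nullhomotopic`, Hatcher §4.1). The frame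
`A(y) = (de⁻¹_{e y} × id)(F((e y - e q) / r))` is continuous on `e.source` (push-forward along the
`C¹` map `e⁻¹`) and linearly independent (`de⁻¹` is injective), and `A = s` on `e⁻¹(S(e q, r))`
(`de⁻¹ ∘ de = id`). The framing equal to `A` on the open chart ball `e⁻¹(B(e q, r)) ∋ q` and to
`s` elsewhere is continuous (`continuous_if`: the frontier of the chart ball lies in
`e⁻¹(S(e q, r))` since `e⁻¹(B̄(e q, r))` is compact, hence closed) and linearly independent
everywhere. [cite: KervaireMilnorAnnals1963, §3, proof of Thm. 3.1, p. 508 (first sentence: oₙ(Σ) the only obstruction)] [cite: Kosinski1993, Ch. IX, (8.2)–(8.4), p. 190] [cite: HatcherAT2002, §4.1 (p. 346)] -/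
theorem isStablyParallelizable_of_nullhomotopic_clutchingMap [T2Space M] {q : M}
    {s : Fin (n + 2) → M → EuclideanSpace ℝ (Fin (n + 1)) × ℝ}
    (hs1 : ∀ i, ContinuousOn (fun y =>
      (TotalSpace.mk' (EuclideanSpace ℝ (Fin (n + 1))) y (s i y).1 : TangentBundle (𝓡 (n + 1)) M))
      ({q}ᶜ : Set M))
    (hs2 : ∀ i, ContinuousOn (fun y => (s i y).2) ({q}ᶜ : Set M))
    (hsli : ∀ y, y ≠ q → LinearIndependent ℝ fun i => s i y)
    {e : OpenPartialHomeomorph M (EuclideanSpace ℝ (Fin (n + 1)))}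
    (he : e ∈ IsManifold.maximalAtlas (𝓡 (n + 1)) 1 M) (hqe : q ∈ e.source)
    {r : ℝ} (hr : 0 < r) (hball : closedBall (e q) r ⊆ e.target)
    (hobs : ∀ f : C(sphere (0 : EuclideanSpace ℝ (Fin (n + 1))) 1, StableFrame (n + 1)),
      (∀ (u : sphere (0 : EuclideanSpace ℝ (Fin (n + 1))) 1) (i : Fin (n + 2)),
        (f u).1 i =
          (mfderiv (𝓡 (n + 1)) (𝓡 (n + 1)) e (e.symm (e q + r • ↑u))
              (s i (e.symm (e q + r • ↑u))).1,
            (s i (e.symm (e q + r • ↑u))).2)) →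
      f.Nullhomotopic) :
    IsStablyParallelizable (𝓡 (n + 1)) M := by
  classical
  -- `b = e q`; the closed ball `B̄(b, r)` lies inside the target of the chart `e`
  let b : EuclideanSpace ℝ (Fin (n + 1)) := e q
  have hφd : e.MDifferentiable (𝓡 (n + 1)) (𝓡 (n + 1)) :=
    mdifferentiable_of_mem_maximalAtlas_one he
  have hφc : ContMDiffOn (𝓡 (n + 1)) (𝓡 (n + 1)) 1 e e.source :=
    contMDiffOn_of_mem_maximalAtlas he
  have hφc' : ContMDiffOn (𝓡 (n + 1)) (𝓡 (n + 1)) 1 e.symm e.target :=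
    contMDiffOn_symm_of_mem_maximalAtlas he
  have hN : finrank ℝ (EuclideanSpace ℝ (Fin (n + 1))) + 1 = n + 2 := by simp
  -- the clutching map: the given framing read in the chart `e`, on `e.source ∖ {q}`
  let γ : M → Fin (n + 2) → EuclideanSpace ℝ (Fin (n + 1)) × ℝ := fun y i =>
    (mfderiv (𝓡 (n + 1)) (𝓡 (n + 1)) e y (s i y).1, (s i y).2)
  have hγli : ∀ y ∈ e.source, y ≠ q → LinearIndependent ℝ (γ y) := by
    intro y hy hyq
    let D : EuclideanSpace ℝ (Fin (n + 1)) →L[ℝ] EuclideanSpace ℝ (Fin (n + 1)) :=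
      mfderiv (𝓡 (n + 1)) (𝓡 (n + 1)) e y
    let L : (EuclideanSpace ℝ (Fin (n + 1)) × ℝ) →ₗ[ℝ] (EuclideanSpace ℝ (Fin (n + 1)) × ℝ) :=
      D.toLinearMap.prodMap (LinearMap.id : ℝ →ₗ[ℝ] ℝ)
    have hinj : Injective L := by
      simp only [L, LinearMap.coe_prodMap]
      exact (hφd.mfderiv_injective hy).prodMap injective_id
    have key : LinearIndependent ℝ (L ∘ fun i => s i y) :=
      (hsli y hyq).map' L (LinearMap.ker_eq_bot.mpr hinj)
    convert key using 1
    funext i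
    rfl
  have hγ1 : ∀ i, ContinuousOn (fun y => (γ y i).1) (e.source ∩ {q}ᶜ) := by
    intro i
    have := ContinuousOn.totalSpaceMk_mfderiv (g := id) e.open_source hφc
      ((hs1 i).mono inter_subset_right) (fun y hy => hy.1)
    exact continuous_snd_tangentBundle_euclidean.comp_continuousOn this
  have hγ2 : ∀ i, ContinuousOn (fun y => (γ y i).2) (e.source ∩ {q}ᶜ) := fun i =>
    (hs2 i).mono inter_subset_right
  -- the clutching map on the sphere of radius `r` about `b = e q`, pulled back to `𝕊ⁿ`
  let ρ : sphere (0 : EuclideanSpace ℝ (Fin (n + 1))) 1 → M := fun u => e.symm (b + r • ↑u)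
  have hρt : ∀ u : sphere (0 : EuclideanSpace ℝ (Fin (n + 1))) 1, b + r • ↑u ∈ e.target := by
    intro u
    refine hball ?_
    rw [mem_closedBall, dist_eq_norm, add_sub_cancel_left, norm_smul, Real.norm_eq_abs,
      abs_of_pos hr, norm_eq_of_mem_sphere u, mul_one]
  have hρ : Continuous ρ :=
    e.continuousOn_symm.comp_continuous (by fun_prop) hρt
  have hρs : ∀ u, ρ u ∈ e.source := fun u => e.map_target (hρt u)
  have hρφ : ∀ u, e (ρ u) = b + r • ↑u := fun u => e.right_inv (hρt u)
  have hρq : ∀ u, ρ u ≠ q := by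
    intro u h
    have h1 := hρφ u
    rw [h] at h1
    have h2 : r • (u : EuclideanSpace ℝ (Fin (n + 1))) = 0 := add_eq_left.mp h1.symm
    rcases smul_eq_zero.mp h2 with h3 | h3
    · exact hr.ne' h3
    · exact ne_zero_of_mem_unit_sphere u h3
  let f : C(sphere (0 : EuclideanSpace ℝ (Fin (n + 1))) 1, StableFrame (n + 1)) :=
    ⟨fun u => ⟨γ (ρ u), hγli _ (hρs u) (hρq u)⟩, by
      refine Continuous.subtype_mk (continuous_pi fun i => Continuous.prodMk ?_ ?_) _
      · exact (hγ1 i).comp_continuous hρ fun u => ⟨hρs u, hρq u⟩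
      · exact (hγ2 i).comp_continuous hρ fun u => ⟨hρs u, hρq u⟩⟩
  -- the obstruction vanishes: `f` is null-homotopic, hence extends over `ℝⁿ⁺¹`
  obtain ⟨F, hF⟩ := exists_sphere_extends_of_nullhomotopic f (hobs f fun u i => rfl)
  -- the new framing over the closed chart ball: the chart framing twisted by `F`
  let uu : M → EuclideanSpace ℝ (Fin (n + 1)) := fun y => r⁻¹ • (e y - b)
  have huu : ContinuousOn uu e.source := by
    change ContinuousOn (fun y => r⁻¹ • (e y - b)) e.source
    have := e.continuousOn
    fun_prop
  let w : Fin (n + 2) → M → EuclideanSpace ℝ (Fin (n + 1)) × ℝ := fun i y => (F (uu y)).1 i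
  have hw : ∀ i, ContinuousOn (w i) e.source := fun i =>
    ((continuous_apply i).comp (continuous_subtype_val.comp F.continuous)).comp_continuousOn huu
  let A : Fin (n + 2) → M → EuclideanSpace ℝ (Fin (n + 1)) × ℝ := fun i y =>
    (mfderiv (𝓡 (n + 1)) (𝓡 (n + 1)) e.symm (e y) (w i y).1, (w i y).2)
  have hA1 : ∀ i, ContinuousOn (fun y => (TotalSpace.mk' (EuclideanSpace ℝ (Fin (n + 1))) y
      (A i y).1 : TangentBundle (𝓡 (n + 1)) M)) e.source := by
    intro i
    have hin : ContinuousOn (fun y => (TotalSpace.mk' (EuclideanSpace ℝ (Fin (n + 1))) (e y)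
        (w i y).1 : TangentBundle (𝓡 (n + 1)) (EuclideanSpace ℝ (Fin (n + 1))))) e.source :=
      ContinuousOn.totalSpaceMk_euclidean e.continuousOn (continuous_fst.comp_continuousOn (hw i))
    have := ContinuousOn.totalSpaceMk_mfderiv (g := e) e.open_target hφc' hin e.mapsTo
    refine this.congr fun y hy => ?_
    change (TotalSpace.mk' (EuclideanSpace ℝ (Fin (n + 1))) y _ : TangentBundle (𝓡 (n + 1)) M) =
      TotalSpace.mk' (EuclideanSpace ℝ (Fin (n + 1))) (e.symm (e y)) _
    rw [e.left_inv hy]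
    rfl
  have hA2 : ∀ i, ContinuousOn (fun y => (A i y).2) e.source := fun i => by
    change ContinuousOn (fun y => (w i y).2) e.source
    exact continuous_snd.comp_continuousOn (hw i)
  have hAli : ∀ y ∈ e.source, LinearIndependent ℝ (fun i => A i y) := by
    intro y hy
    let D : EuclideanSpace ℝ (Fin (n + 1)) →L[ℝ] EuclideanSpace ℝ (Fin (n + 1)) :=
      mfderiv (𝓡 (n + 1)) (𝓡 (n + 1)) e.symm (e y)
    let L : (EuclideanSpace ℝ (Fin (n + 1)) × ℝ) →ₗ[ℝ] (EuclideanSpace ℝ (Fin (n + 1)) × ℝ) :=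
      D.toLinearMap.prodMap (LinearMap.id : ℝ →ₗ[ℝ] ℝ)
    have hinj : Injective L := by
      simp only [L, LinearMap.coe_prodMap]
      exact (hφd.symm.mfderiv_injective (e.map_source hy)).prodMap injective_id
    have key : LinearIndependent ℝ (L ∘ fun i => w i y) :=
      (F (uu y)).2.map' L (LinearMap.ker_eq_bot.mpr hinj)
    convert key using 1
    funext i
    rfl
  -- on the sphere `e⁻¹ (S(b, r))` the new framing agrees with the given one
  have hagree : ∀ i, ∀ y ∈ e.symm '' sphere b r, A i y = s i y := by
    rintro i _ ⟨x, hx, rfl⟩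
    have hxt : x ∈ e.target := hball (sphere_subset_closedBall hx)
    have hys : e.symm x ∈ e.source := e.map_target hxt
    have hux : ‖r⁻¹ • (x - b)‖ = 1 := by
      rw [norm_smul, norm_inv, Real.norm_eq_abs, abs_of_pos hr, ← dist_eq_norm, mem_sphere.mp hx,
        inv_mul_cancel₀ hr.ne']
    let u : sphere (0 : EuclideanSpace ℝ (Fin (n + 1))) 1 :=
      ⟨r⁻¹ • (x - b), mem_sphere_zero_iff_norm.mpr hux⟩
    have hρu : ρ u = e.symm x := by
      change e.symm (b + r • (r⁻¹ • (x - b))) = e.symm x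
      rw [smul_inv_smul₀ hr.ne', add_sub_cancel]
    have hwu : w i (e.symm x) = γ (e.symm x) i := by
      change (F (r⁻¹ • (e (e.symm x) - b))).1 i = _
      rw [e.right_inv hxt]
      change (F (u : EuclideanSpace ℝ (Fin (n + 1)))).1 i = _
      rw [hF u]
      change γ (ρ u) i = _
      rw [hρu]
    change (mfderiv (𝓡 (n + 1)) (𝓡 (n + 1)) e.symm (e (e.symm x)) (w i (e.symm x)).1,
      (w i (e.symm x)).2) = s i (e.symm x)
    rw [hwu]
    change (mfderiv (𝓡 (n + 1)) (𝓡 (n + 1)) e.symm (e (e.symm x))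
      (mfderiv (𝓡 (n + 1)) (𝓡 (n + 1)) e (e.symm x) (s i (e.symm x)).1),
      (s i (e.symm x)).2) = s i (e.symm x)
    have key : mfderiv (𝓡 (n + 1)) (𝓡 (n + 1)) e.symm (e (e.symm x))
        (mfderiv (𝓡 (n + 1)) (𝓡 (n + 1)) e (e.symm x) (s i (e.symm x)).1) =
        (s i (e.symm x)).1 :=
      DFunLike.congr_fun (hφd.symm_comp_deriv hys) (s i (e.symm x)).1
    rw [key]
    rfl
  -- the open chart ball `O ∋ q`, its closure and frontier
  let O : Set M := e.source ∩ e ⁻¹' ball b r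
  have hO : IsOpen O := e.isOpen_inter_preimage isOpen_ball
  have hqO : q ∈ O := ⟨hqe, mem_ball_self hr⟩
  have hOs : O ⊆ e.source := inter_subset_left
  have hD : IsClosed (e.symm '' closedBall b r) :=
    ((isCompact_closedBall b r).image_of_continuousOn (e.continuousOn_symm.mono hball)).isClosed
  have hOD : O ⊆ e.symm '' closedBall b r := fun y hy =>
    ⟨e y, ball_subset_closedBall hy.2, e.left_inv hy.1⟩
  have hclO : closure O ⊆ e.symm '' closedBall b r := closure_minimal hOD hD
  have hDs : e.symm '' closedBall b r ⊆ e.source := by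
    rintro _ ⟨x, hx, rfl⟩
    exact e.map_target (hball hx)
  have hfrO : frontier O ⊆ e.symm '' sphere b r := by
    intro y hy
    rw [frontier, hO.interior_eq] at hy
    obtain ⟨x, hx, rfl⟩ := hclO hy.1
    have hxt : x ∈ e.target := hball hx
    refine ⟨x, ?_, rfl⟩
    have hnot : e (e.symm x) ∉ ball b r := fun h => hy.2 ⟨e.map_target hxt, h⟩
    rw [e.right_inv hxt] at hnot
    exact le_antisymm (mem_closedBall.mp hx) (not_lt.mp fun h => hnot (mem_ball.mpr h))
  -- the global stable framing: `A` on `O`, the given one outside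
  let S : Fin (n + 2) → M → EuclideanSpace ℝ (Fin (n + 1)) × ℝ := fun i y =>
    if y ∈ O then A i y else s i y
  have hfr : ∀ i, ∀ y ∈ frontier O, A i y = s i y := fun i y hy => hagree i y (hfrO hy)
  have hOc : closure {y | ¬ y ∈ O} ⊆ ({q}ᶜ : Set M) := by
    rw [show {y | ¬ y ∈ O} = Oᶜ from rfl, hO.isClosed_compl.closure_eq]
    exact compl_subset_compl.mpr (singleton_subset_iff.mpr hqO)
  have hS1 : ∀ i, Continuous fun y => (TotalSpace.mk' (EuclideanSpace ℝ (Fin (n + 1))) y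
      (S i y).1 : TangentBundle (𝓡 (n + 1)) M) := by
    intro i
    have := continuous_if (p := fun y => y ∈ O)
      (f := fun y => (TotalSpace.mk' (EuclideanSpace ℝ (Fin (n + 1))) y (A i y).1 :
        TangentBundle (𝓡 (n + 1)) M))
      (g := fun y => (TotalSpace.mk' (EuclideanSpace ℝ (Fin (n + 1))) y (s i y).1 :
        TangentBundle (𝓡 (n + 1)) M))
      (fun y hy => by rw [hfr i y hy]) ((hA1 i).mono (hclO.trans hDs)) ((hs1 i).mono hOc)
    convert this using 1
    funext y
    simp only [S]
    split_ifs <;> rfl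
  have hS2 : ∀ i, Continuous (fun y => (S i y).2) := by
    intro i
    have := continuous_if (p := fun y => y ∈ O) (f := fun y => (A i y).2)
      (g := fun y => (s i y).2)
      (fun y hy => by rw [hfr i y hy]) ((hA2 i).mono (hclO.trans hDs)) ((hs2 i).mono hOc)
    convert this using 1
    funext y
    simp only [S]
    split_ifs <;> rfl
  have hSli : ∀ y, LinearIndependent ℝ (fun i => S i y) := by
    intro y
    by_cases hy : y ∈ O
    · simp only [S, if_pos hy]
      exact hAli y (hOs hy)
    · simp only [S, if_neg hy]
      exact hsli y fun h => hy (h ▸ hqO)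
  -- reindex by `Fin (finrank ℝ ℝⁿ⁺¹ + 1)`
  refine ⟨fun i => S (Fin.cast hN i), fun i => hS1 _, fun i => hS2 _, fun y => ?_⟩
  exact (hSli y).comp (Fin.cast hN) (Fin.cast_injective _)

/-- The tree's clutching theorem recovered: if **every** map `𝕊ⁿ → StableFrame (n + 1)` extends
over `ℝⁿ⁺¹` (`SphereMapsToStableFramesExtend n`, "`πₙ(GL(n + 2, ℝ)) = 0`" — Case 1 of the
printed proof), the clutching map of any data is null-homotopic
(`nullhomotopic_of_sphere_extends`), so a manifold with `TM ⊕ ℝ` framed off a point is stably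
parallelizable (cf. `isStablyParallelizable_of_hasStableTangentFramingAlong_compl_singleton`).
[cite: KervaireMilnorAnnals1963, §3, proof of Thm. 3.1, p. 508 (Case 1)] -/
theorem isStablyParallelizable_of_sphereMapsToStableFramesExtend_of_compl_singleton [T2Space M]
    (hext : SphereMapsToStableFramesExtend n) {q : M}
    (hq : HasStableTangentFramingAlong (𝓡 (n + 1)) M ((↑) : ((({q} : Set M)ᶜ : Set M)) → M)) :
    IsStablyParallelizable (𝓡 (n + 1)) M := by
  obtain ⟨s, hs1, hs2, hsli⟩ := hq.exists_sections_compl_singleton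
  obtain ⟨r, hr, hball⟩ : ∃ r > (0 : ℝ),
      closedBall (chartAt (EuclideanSpace ℝ (Fin (n + 1))) q q) r ⊆
        (chartAt (EuclideanSpace ℝ (Fin (n + 1))) q).target := by
    obtain ⟨r, hr, h⟩ := Metric.isOpen_iff.mp
      (chartAt (EuclideanSpace ℝ (Fin (n + 1))) q).open_target _ (mem_chart_target _ q)
    exact ⟨r / 2, half_pos hr, (closedBall_subset_ball (half_lt_self hr)).trans h⟩
  exact isStablyParallelizable_of_nullhomotopic_clutchingMap hs1 hs2 hsli
    (IsManifold.chart_mem_maximalAtlas q) (mem_chart_source _ q) hr hball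
    fun f _ => by
      obtain ⟨F, hF⟩ := hext f
      exact nullhomotopic_of_sphere_extends f F hF

/-! ### 3. A global framing has null-homotopic clutching map; the equivalence -/

/-- **Kervaire–Milnor's obstruction, necessity: the clutching map of a framing defined across
the puncture is null-homotopic.** If the sections `sᵢ` frame `TM ⊕ ℝ` over the whole chart
domain `e.source ∋ q` (continuous into `TM ⊕ ℝ`, linearly independent), then the clutching map
`f(u)ᵢ = (de (sᵢ y).1, (sᵢ y).2)`, `y = e⁻¹(e q + r u)`, is null-homotopic: shrinking the sphere
to its centre inside the chart ball, `H(t, u) = ` the same expression at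
`y = e⁻¹(e q + (1 - t) r u)`, is a homotopy through stable frames from `f` to the constant frame
read at `q` (the trivial direction of "`oₙ(Σ)` is the only obstruction", Kervaire–Milnor p. 508;
Kosinski IX (8.2): a framing over the disc has trivial clutching class).
[cite: KervaireMilnorAnnals1963, §3, proof of Thm. 3.1, p. 508] [cite: Kosinski1993, Ch. IX, (8.2), p. 190] -/
theorem nullhomotopic_clutchingMap_of_framing
    {s : Fin (n + 2) → M → EuclideanSpace ℝ (Fin (n + 1)) × ℝ}
    {e : OpenPartialHomeomorph M (EuclideanSpace ℝ (Fin (n + 1)))}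
    (he : e ∈ IsManifold.maximalAtlas (𝓡 (n + 1)) 1 M)
    (hs1 : ∀ i, ContinuousOn (fun y =>
      (TotalSpace.mk' (EuclideanSpace ℝ (Fin (n + 1))) y (s i y).1 : TangentBundle (𝓡 (n + 1)) M))
      e.source)
    (hs2 : ∀ i, ContinuousOn (fun y => (s i y).2) e.source)
    (hsli : ∀ y ∈ e.source, LinearIndependent ℝ fun i => s i y)
    {q : M} (hqe : q ∈ e.source) {r : ℝ} (hr : 0 < r) (hball : closedBall (e q) r ⊆ e.target)
    (f : C(sphere (0 : EuclideanSpace ℝ (Fin (n + 1))) 1, StableFrame (n + 1)))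
    (hf : ∀ (u : sphere (0 : EuclideanSpace ℝ (Fin (n + 1))) 1) (i : Fin (n + 2)),
      (f u).1 i =
        (mfderiv (𝓡 (n + 1)) (𝓡 (n + 1)) e (e.symm (e q + r • ↑u))
            (s i (e.symm (e q + r • ↑u))).1,
          (s i (e.symm (e q + r • ↑u))).2)) :
    f.Nullhomotopic := by
  have hφd : e.MDifferentiable (𝓡 (n + 1)) (𝓡 (n + 1)) :=
    mdifferentiable_of_mem_maximalAtlas_one he
  have hφc : ContMDiffOn (𝓡 (n + 1)) (𝓡 (n + 1)) 1 e e.source :=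
    contMDiffOn_of_mem_maximalAtlas he
  -- the framing read in the chart
  let γ : M → Fin (n + 2) → EuclideanSpace ℝ (Fin (n + 1)) × ℝ := fun y i =>
    (mfderiv (𝓡 (n + 1)) (𝓡 (n + 1)) e y (s i y).1, (s i y).2)
  have hγli : ∀ y ∈ e.source, LinearIndependent ℝ (γ y) := by
    intro y hy
    let D : EuclideanSpace ℝ (Fin (n + 1)) →L[ℝ] EuclideanSpace ℝ (Fin (n + 1)) :=
      mfderiv (𝓡 (n + 1)) (𝓡 (n + 1)) e y
    let L : (EuclideanSpace ℝ (Fin (n + 1)) × ℝ) →ₗ[ℝ] (EuclideanSpace ℝ (Fin (n + 1)) × ℝ) :=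
      D.toLinearMap.prodMap (LinearMap.id : ℝ →ₗ[ℝ] ℝ)
    have hinj : Injective L := by
      simp only [L, LinearMap.coe_prodMap]
      exact (hφd.mfderiv_injective hy).prodMap injective_id
    have key : LinearIndependent ℝ (L ∘ fun i => s i y) :=
      (hsli y hy).map' L (LinearMap.ker_eq_bot.mpr hinj)
    convert key using 1
    funext i
    rfl
  have hγ1 : ∀ i, ContinuousOn (fun y => (γ y i).1) e.source := by
    intro i
    have := ContinuousOn.totalSpaceMk_mfderiv (g := id) e.open_source hφc (hs1 i)
      (mapsTo_id _)
    exact continuous_snd_tangentBundle_euclidean.comp_continuousOn this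
  have hγ2 : ∀ i, ContinuousOn (fun y => (γ y i).2) e.source := hs2
  -- the shrinking spheres `c (t, u) = e⁻¹ (e q + ((1 - t) r) u)` inside the chart ball
  let c : I × sphere (0 : EuclideanSpace ℝ (Fin (n + 1))) 1 → M := fun p =>
    e.symm (e q + ((1 - (p.1 : ℝ)) * r) • ↑p.2)
  have hct : ∀ p : I × sphere (0 : EuclideanSpace ℝ (Fin (n + 1))) 1,
      e q + ((1 - (p.1 : ℝ)) * r) • (↑p.2 : EuclideanSpace ℝ (Fin (n + 1))) ∈ e.target := by
    intro p
    refine hball ?_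
    have h0 : 0 ≤ 1 - (p.1 : ℝ) := sub_nonneg.mpr p.1.2.2
    have h1 : (1 - (p.1 : ℝ)) * r ≤ r := by nlinarith [p.1.2.1]
    rw [mem_closedBall, dist_eq_norm, add_sub_cancel_left, norm_smul, Real.norm_eq_abs,
      abs_of_nonneg (mul_nonneg h0 hr.le), norm_eq_of_mem_sphere p.2, mul_one]
    exact h1
  have hc : Continuous c := e.continuousOn_symm.comp_continuous (by fun_prop) hct
  have hcs : ∀ p, c p ∈ e.source := fun p => e.map_target (hct p)
  let H : I × sphere (0 : EuclideanSpace ℝ (Fin (n + 1))) 1 → StableFrame (n + 1) := fun p =>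
    ⟨γ (c p), hγli _ (hcs p)⟩
  have hH : Continuous H := by
    refine Continuous.subtype_mk (continuous_pi fun i => Continuous.prodMk ?_ ?_) _
    · exact (hγ1 i).comp_continuous hc hcs
    · exact (hγ2 i).comp_continuous hc hcs
  have hq' : e.symm (e q) ∈ e.source := by rw [e.left_inv hqe]; exact hqe
  let y₀ : StableFrame (n + 1) := ⟨γ (e.symm (e q)), hγli _ hq'⟩
  refine ⟨y₀, ⟨{ toFun := H, continuous_toFun := hH, map_zero_left := ?_, map_one_left := ?_ }⟩⟩
  · intro u
    apply Subtype.ext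
    funext i
    rw [hf u i]
    have hc0 : c (0, u) = e.symm (e q + r • ↑u) := by
      change e.symm (e q + ((1 - ((0 : I) : ℝ)) * r) • ↑u) = _
      rw [Set.Icc.coe_zero, sub_zero, one_mul]
    change γ (c (0, u)) i = _
    rw [hc0]
    rfl
  · intro u
    apply Subtype.ext
    funext i
    have hc1 : c (1, u) = e.symm (e q) := by
      change e.symm (e q + ((1 - ((1 : I) : ℝ)) * r) • ↑u) = _
      rw [Set.Icc.coe_one, sub_self, zero_mul, zero_smul, add_zero]
    change γ (c (1, u)) i = γ (e.symm (e q)) i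
    rw [hc1]

/-- **A stably parallelizable manifold has null-homotopic clutching maps**: a global framing of
`TM ⊕ ℝ` (`IsStablyParallelizable`), reindexed as `n + 2` everywhere-continuous, everywhere
linearly independent sections `Sᵢ : M → ℝⁿ⁺¹ × ℝ`, has null-homotopic clutching map for every
chart `e` of the maximal `C¹` atlas, every `q ∈ e.source` and every `B̄(e q, r) ⊆ e.target`
(`nullhomotopic_clutchingMap_of_framing`). Kervaire–Milnor p. 508: if `τ ⊕ ε¹` is trivial then
`oₙ(Σ) = 0`. [cite: KervaireMilnorAnnals1963, §3, proof of Thm. 3.1, p. 508] -/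
theorem IsStablyParallelizable.exists_sections_nullhomotopic_clutchingMap
    (h : IsStablyParallelizable (𝓡 (n + 1)) M) :
    ∃ S : Fin (n + 2) → M → EuclideanSpace ℝ (Fin (n + 1)) × ℝ,
      (∀ i, Continuous fun y => (TotalSpace.mk' (EuclideanSpace ℝ (Fin (n + 1))) y (S i y).1 :
        TangentBundle (𝓡 (n + 1)) M)) ∧
      (∀ i, Continuous fun y => (S i y).2) ∧ (∀ y, LinearIndependent ℝ fun i => S i y) ∧
      ∀ (e : OpenPartialHomeomorph M (EuclideanSpace ℝ (Fin (n + 1)))),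
        e ∈ IsManifold.maximalAtlas (𝓡 (n + 1)) 1 M → ∀ (q : M), q ∈ e.source →
        ∀ (r : ℝ), 0 < r → closedBall (e q) r ⊆ e.target →
        ∀ f : C(sphere (0 : EuclideanSpace ℝ (Fin (n + 1))) 1, StableFrame (n + 1)),
          (∀ (u : sphere (0 : EuclideanSpace ℝ (Fin (n + 1))) 1) (i : Fin (n + 2)),
            (f u).1 i =
              (mfderiv (𝓡 (n + 1)) (𝓡 (n + 1)) e (e.symm (e q + r • ↑u))
                  (S i (e.symm (e q + r • ↑u))).1,
                (S i (e.symm (e q + r • ↑u))).2)) →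
          f.Nullhomotopic := by
  have hN : finrank ℝ (EuclideanSpace ℝ (Fin (n + 1))) + 1 = n + 2 := by simp
  obtain ⟨s₀, h1, h2, hli⟩ := h
  refine ⟨fun i => s₀ (Fin.cast hN.symm i), fun i => h1 _, fun i => h2 _,
    fun y => (hli y).comp (Fin.cast hN.symm) (Fin.cast_injective _), ?_⟩
  intro e he q hqe r hr hball f hf
  exact nullhomotopic_clutchingMap_of_framing he (fun i => (h1 _).continuousOn)
    (fun i => (h2 _).continuousOn)
    (fun y _ => (hli y).comp (Fin.cast hN.symm) (Fin.cast_injective _)) hqe hr hball f hf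

/-- **"The only obstruction to the triviality of `τ ⊕ ε¹` is the clutching class"** (Kervaire–
Milnor 1963, proof of Thm. 3.1, p. 508, first sentence; Kosinski IX (8.2)–(8.4)), as an
equivalence for a nonempty Hausdorff `C¹` manifold `M` modelled on `ℝⁿ⁺¹`: `M` is stably
parallelizable iff, for some point `q`, `TM ⊕ ℝ` is framed off `q` by sections whose clutching
map in the chart `φ = chartAt q`, on some sphere of radius `r` about `q` with `B̄(φ q, r) ⊆`
`φ.target`, is null-homotopic. (`→`: restrict a global framing and shrink the sphere,
`IsStablyParallelizable.exists_sections_nullhomotopic_clutchingMap`; `←`: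
`isStablyParallelizable_of_nullhomotopic_clutchingMap`.)
[cite: KervaireMilnorAnnals1963, §3, proof of Thm. 3.1, p. 508 (first sentence)] [cite: Kosinski1993, Ch. IX, (8.2)–(8.4), p. 190] -/
theorem isStablyParallelizable_iff_exists_nullhomotopic_clutchingMap [T2Space M] [Nonempty M] :
    IsStablyParallelizable (𝓡 (n + 1)) M ↔
      ∃ (q : M) (s : Fin (n + 2) → M → EuclideanSpace ℝ (Fin (n + 1)) × ℝ) (r : ℝ),
        (∀ i, ContinuousOn (fun y => (TotalSpace.mk' (EuclideanSpace ℝ (Fin (n + 1))) y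
          (s i y).1 : TangentBundle (𝓡 (n + 1)) M)) ({q}ᶜ : Set M)) ∧
        (∀ i, ContinuousOn (fun y => (s i y).2) ({q}ᶜ : Set M)) ∧
        (∀ y, y ≠ q → LinearIndependent ℝ fun i => s i y) ∧
        0 < r ∧ closedBall (chartAt (EuclideanSpace ℝ (Fin (n + 1))) q q) r ⊆
          (chartAt (EuclideanSpace ℝ (Fin (n + 1))) q).target ∧
        ∀ f : C(sphere (0 : EuclideanSpace ℝ (Fin (n + 1))) 1, StableFrame (n + 1)),
          (∀ (u : sphere (0 : EuclideanSpace ℝ (Fin (n + 1))) 1) (i : Fin (n + 2)),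
            (f u).1 i =
              (mfderiv (𝓡 (n + 1)) (𝓡 (n + 1)) (chartAt (EuclideanSpace ℝ (Fin (n + 1))) q)
                  ((chartAt (EuclideanSpace ℝ (Fin (n + 1))) q).symm
                    (chartAt (EuclideanSpace ℝ (Fin (n + 1))) q q + r • ↑u))
                  (s i ((chartAt (EuclideanSpace ℝ (Fin (n + 1))) q).symm
                    (chartAt (EuclideanSpace ℝ (Fin (n + 1))) q q + r • ↑u))).1,
                (s i ((chartAt (EuclideanSpace ℝ (Fin (n + 1))) q).symm
                  (chartAt (EuclideanSpace ℝ (Fin (n + 1))) q q + r • ↑u))).2)) →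
          f.Nullhomotopic := by
  constructor
  · intro h
    obtain ⟨S, hS1, hS2, hSli, hnull⟩ := h.exists_sections_nullhomotopic_clutchingMap
    let q : M := Classical.arbitrary M
    obtain ⟨r, hr, hball⟩ : ∃ r > (0 : ℝ),
        closedBall (chartAt (EuclideanSpace ℝ (Fin (n + 1))) q q) r ⊆
          (chartAt (EuclideanSpace ℝ (Fin (n + 1))) q).target := by
      obtain ⟨r, hr, h⟩ := Metric.isOpen_iff.mp
        (chartAt (EuclideanSpace ℝ (Fin (n + 1))) q).open_target _ (mem_chart_target _ q)
      exact ⟨r / 2, half_pos hr, (closedBall_subset_ball (half_lt_self hr)).trans h⟩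
    exact ⟨q, S, r, fun i => (hS1 i).continuousOn, fun i => (hS2 i).continuousOn,
      fun y _ => hSli y, hr, hball, fun f hf => hnull _ (IsManifold.chart_mem_maximalAtlas q) q
        (mem_chart_source _ q) r hr hball f hf⟩
  · rintro ⟨q, s, r, hs1, hs2, hsli, hr, hball, hobs⟩
    exact isStablyParallelizable_of_nullhomotopic_clutchingMap hs1 hs2 hsli
      (IsManifold.chart_mem_maximalAtlas q) (mem_chart_source _ q) hr hball hobs

end Clutching

/-! ### 4. Homotopy spheres: Thm. 3.1 from Bott's values and the vanishing of `oₙ(Σ)` -/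

namespace HomotopySphere

variable {n : ℕ}

/-- **Clutching data exist on every homotopy sphere**: for every point `q` of a homotopy
`(n + 1)`-sphere there are sections framing `TΣ ⊕ ℝ` off `q` — the tree's theorem
`hasStableTangentFramingAlong_compl_singleton_holds` (`Σ ∖ {q}` is contractible; covering
homotopy theorem), in the global-section form of
`HasStableTangentFramingAlong.exists_sections_compl_singleton` — and a radius `r > 0` with
`B̄(·, r)` inside the target of `chartAt q`. So the clutching map of Kervaire–Milnor's `oₙ₊₁(Σ)`
is always defined. [cite: KervaireMilnorAnnals1963, §3, proof of Thm. 3.1, p. 508 (first sentence)] -/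
theorem exists_clutchingData (S : HomotopySphere (n + 1)) (q : S.carrier) :
    ∃ (s : Fin (n + 2) → S.carrier → EuclideanSpace ℝ (Fin (n + 1)) × ℝ) (r : ℝ),
      (∀ i, ContinuousOn (fun y => (TotalSpace.mk' (EuclideanSpace ℝ (Fin (n + 1))) y
        (s i y).1 : TangentBundle (𝓡 (n + 1)) S.carrier)) ({q}ᶜ : Set S.carrier)) ∧
      (∀ i, ContinuousOn (fun y => (s i y).2) ({q}ᶜ : Set S.carrier)) ∧
      (∀ y, y ≠ q → LinearIndependent ℝ fun i => s i y) ∧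
      0 < r ∧ closedBall (chartAt (EuclideanSpace ℝ (Fin (n + 1))) q q) r ⊆
        (chartAt (EuclideanSpace ℝ (Fin (n + 1))) q).target := by
  obtain ⟨s, hs1, hs2, hsli⟩ :=
    (hasStableTangentFramingAlong_compl_singleton_holds (n + 1) S
      q).exists_sections_compl_singleton
  obtain ⟨r, hr, hball⟩ : ∃ r > (0 : ℝ),
      closedBall (chartAt (EuclideanSpace ℝ (Fin (n + 1))) q q) r ⊆
        (chartAt (EuclideanSpace ℝ (Fin (n + 1))) q).target := by
    obtain ⟨r, hr, h⟩ := Metric.isOpen_iff.mp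
      (chartAt (EuclideanSpace ℝ (Fin (n + 1))) q).open_target _ (mem_chart_target _ q)
    exact ⟨r / 2, half_pos hr, (closedBall_subset_ball (half_lt_self hr)).trans h⟩
  exact ⟨s, r, hs1, hs2, hsli, hr, hball⟩

/-- **Thm. 3.1 in dimension `n + 1` from the vanishing of the obstruction** (Kervaire–Milnor
p. 508: "the only obstruction to the triviality of `τ ⊕ ε¹` is … `oₙ(Σ)`"): a homotopy
`(n + 1)`-sphere some clutching data of which (a point `q`, sections framing `TΣ ⊕ ℝ` off `q`, a
chart `e` of the maximal `C¹` atlas at `q`, a radius) have null-homotopic clutching map is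
s-parallelizable. [cite: KervaireMilnorAnnals1963, §3, proof of Thm. 3.1, p. 508 (first sentence)] -/
theorem isStablyParallelizable_of_nullhomotopic_clutchingMap (S : HomotopySphere (n + 1))
    {q : S.carrier} {s : Fin (n + 2) → S.carrier → EuclideanSpace ℝ (Fin (n + 1)) × ℝ}
    (hs1 : ∀ i, ContinuousOn (fun y => (TotalSpace.mk' (EuclideanSpace ℝ (Fin (n + 1))) y
      (s i y).1 : TangentBundle (𝓡 (n + 1)) S.carrier)) ({q}ᶜ : Set S.carrier))
    (hs2 : ∀ i, ContinuousOn (fun y => (s i y).2) ({q}ᶜ : Set S.carrier))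
    (hsli : ∀ y, y ≠ q → LinearIndependent ℝ fun i => s i y)
    {e : OpenPartialHomeomorph S.carrier (EuclideanSpace ℝ (Fin (n + 1)))}
    (he : e ∈ IsManifold.maximalAtlas (𝓡 (n + 1)) 1 S.carrier) (hqe : q ∈ e.source)
    {r : ℝ} (hr : 0 < r) (hball : closedBall (e q) r ⊆ e.target)
    (hobs : ∀ f : C(sphere (0 : EuclideanSpace ℝ (Fin (n + 1))) 1, StableFrame (n + 1)),
      (∀ (u : sphere (0 : EuclideanSpace ℝ (Fin (n + 1))) 1) (i : Fin (n + 2)),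
        (f u).1 i =
          (mfderiv (𝓡 (n + 1)) (𝓡 (n + 1)) e (e.symm (e q + r • ↑u))
              (s i (e.symm (e q + r • ↑u))).1,
            (s i (e.symm (e q + r • ↑u))).2)) →
      f.Nullhomotopic) :
    IsStablyParallelizable (𝓡 (n + 1)) S.carrier :=
  Literature.Topology.FourManifolds.isStablyParallelizable_of_nullhomotopic_clutchingMap
    hs1 hs2 hsli he hqe hr hball hobs

/-- **What remains of Thm. 3.1, in the shape of the printed proof.** The named fact
`HomotopySphere.isStablyParallelizable` (every homotopy sphere is s-parallelizable) follows from

* (i) **Case 1** (`n ≡ 3, 5, 6, 7 (mod 8)`, `n ≥ 5`; `n = 3` is proved in `…Three.lean`): Bott's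
  values `π_ (n - 1) (SO(n + 1), 1) = 0` (Kervaire–Milnor p. 508: "`πₙ₋₁(SO) = 0`, so that
  `oₙ(Σ)` is trivially zero"; Bott 1959), and
* (ii) **Cases 2 and 3** (`n = 4` and `n ≡ 0, 1, 2, 4 (mod 8)`, `n ≥ 8`; written `n = m + 1`):
  for every homotopy `n`-sphere `Σ`, **`oₙ(Σ) = 0`** — some clutching data of `Σ` (a point, a
  framing of `τ ⊕ ε¹` off it, a chart of the maximal atlas, a radius) have null-homotopic
  clutching map. Kervaire–Milnor prove this from the proportionality of `pₖ(Σ)` and `oₙ(Σ)`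
  with Hirzebruch's signature theorem (Case 2, p. 508) and from Rohlin's `Jₙ₋₁ oₙ(Σ) = 0` with
  Adams' injectivity of `Jₙ₋₁` (Case 3, p. 509); these inputs are absent from Mathlib and the
  tree,

given that "`oₙ(Σ)` is the only obstruction" is now the theorem
`isStablyParallelizable_of_nullhomotopic_clutchingMap`. Dimensions `≤ 3` are unconditional.
[cite: KervaireMilnorAnnals1963, §3, Thm. 3.1 and its proof, pp. 508–509 (first sentence; Cases 1, 2, 3)]
[cite: HatcherAT2002, §4.2, Example 4.55 (Bott's table, stability)] -/
theorem isStablyParallelizable_of_bott_of_obstruction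
    (hBott : ∀ n : ℕ, 5 ≤ n → (n % 8 = 3 ∨ n % 8 = 5 ∨ n % 8 = 6 ∨ n % 8 = 7) →
      Subsingleton (π_ (n - 1) (Matrix.specialOrthogonalGroup (Fin (n + 1)) ℝ) 1))
    (hObs : ∀ m : ℕ, 3 ≤ m →
      ((m + 1) % 8 = 0 ∨ (m + 1) % 8 = 1 ∨ (m + 1) % 8 = 2 ∨ (m + 1) % 8 = 4) →
      ∀ S : HomotopySphere (m + 1),
        ∃ (q : S.carrier) (s : Fin (m + 2) → S.carrier → EuclideanSpace ℝ (Fin (m + 1)) × ℝ)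
          (e : OpenPartialHomeomorph S.carrier (EuclideanSpace ℝ (Fin (m + 1)))) (r : ℝ),
          (∀ i, ContinuousOn (fun y => (TotalSpace.mk' (EuclideanSpace ℝ (Fin (m + 1))) y
            (s i y).1 : TangentBundle (𝓡 (m + 1)) S.carrier)) ({q}ᶜ : Set S.carrier)) ∧
          (∀ i, ContinuousOn (fun y => (s i y).2) ({q}ᶜ : Set S.carrier)) ∧
          (∀ y, y ≠ q → LinearIndependent ℝ fun i => s i y) ∧
          e ∈ IsManifold.maximalAtlas (𝓡 (m + 1)) 1 S.carrier ∧ q ∈ e.source ∧ 0 < r ∧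
          closedBall (e q) r ⊆ e.target ∧
          ∀ f : C(sphere (0 : EuclideanSpace ℝ (Fin (m + 1))) 1, StableFrame (m + 1)),
            (∀ (u : sphere (0 : EuclideanSpace ℝ (Fin (m + 1))) 1) (i : Fin (m + 2)),
              (f u).1 i =
                (mfderiv (𝓡 (m + 1)) (𝓡 (m + 1)) e (e.symm (e q + r • ↑u))
                    (s i (e.symm (e q + r • ↑u))).1,
                  (s i (e.symm (e q + r • ↑u))).2)) →
            f.Nullhomotopic) :
    isStablyParallelizable := by
  refine isStablyParallelizable_of_bott_of_cases hBott fun n hn hres S => ?_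
  obtain ⟨m, rfl⟩ : ∃ m, n = m + 1 := ⟨n - 1, by omega⟩
  obtain ⟨q, s, e, r, hs1, hs2, hsli, he, hqe, hr, hball, hobs⟩ := hObs m (by omega) hres S
  exact S.isStablyParallelizable_of_nullhomotopic_clutchingMap hs1 hs2 hsli he hqe hr hball hobs

end HomotopySphere

end Literature.Topology.FourManifolds
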